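import Summits.CriticalPhenomena.PercolationContinuityZ3.Theorems.PercNearOneGluingNoHeavyLowerTailAntitheticFreezeBoxes
import Summits.CriticalPhenomena.PercolationContinuityZ3.Theorems.PercNearOneGluingNoHeavyLowerTailAntitheticNestedTop
import HarnessLib

/-!
# `NoHeavyLowerTail` (stmt-CriticalPhenomena-4575) — antithetic cluster pairs: **THE |R| = 1 VERTEX ANTITHETIC INEQUALITY REDUCES TO
# THE TOP EVENT** — `D({P}) = {P ∉ Y} ⊔ {P ∈ Y ∖ X}`, block freezing, reflection (prim-hp-2 gen 69, HOME/MEMO-gen69.md §1)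

Support file (`--supports stmt-CriticalPhenomena-4575`, hull-port prover `prim-hp-2`, gen 69).  No definitions, no named facts, no sorries;
standard axioms.  VERTEX version: `T ⊆ Sym2 V` the red pairs, `X T = openCluster (T ∩ E) s`, `Y T = openCluster (Tᶜ ∩ E) s`.

The |R| = 1 VERTEX ANTITHETIC INEQUALITY at `P` for the rooted graph `(E, s)` is
  VERTEX({P}):  `0 ≤ Σ_{T : ¬(P ∈ X T ∧ P ∈ Y T)} (F(X T) − F(Y T))·(G(X T) − G(Y T))`   for all monotone `F, G : Set V → ℝ`
(conjectured for every finite graph; the conclusion of every handle / ear theorem of this series at `R = {x}`).  Split the event: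
`¬(P ∈ X ∧ P ∈ Y) ⟺ P ∉ Y  ∨  (P ∈ Y ∧ P ∉ X)`.
* On `{P ∉ Y}` the sum is nonnegative on EVERY graph: block freezing (`Antithetic.Box.notY_sum_nonneg`, …AntitheticFreezeBoxes, gen 63;
  HOME/THEOREM-OneSided.md Lemma 2).
* `{P ∈ Y ∖ X}` is the mirror image under `T ↦ Tᶜ` (which exchanges `X` and `Y`) of the TOP EVENT `{P ∈ X ∖ Y}`, and the summand
  `(F(X) − F(Y))(G(X) − G(Y))` is invariant under the exchange.
Hence (`TopVertex.vertex_sum_nonneg_of_top`):  **TOP(E; P) ⇒ VERTEX({P})** on every graph, where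
  TOP(E; P):  `0 ≤ Σ_{T : P ∈ X T, P ∉ Y T} (F(X T) − F(Y T))·(G(X T) − G(Y T))`  for all monotone `F, G`
(the odd form; the shifted form TOP_shift of …AntitheticTopEar — `F⁺(X) − F⁻(Y)` with `F⁻ ≤ F⁺` — is stronger).  So CONJECTURE T of
HOME/MEMO-gen69.md (TOP_shift for every rooted graph and vertex; exact for all connected rooted graphs on ≤ 6 vertices, no failure known)
implies the whole |R| = 1 vertex antithetic conjecture, at vertices of ANY degree, with no orientation alternative (compare the degree-2
reduction …AntitheticMixedVertex: Δ2 at `x` ⟸ (M)_shift(G − x; y, z) OR (z, y), and THEOREM OS⊕-B* of HOME/THEOREM-OneSided.md).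
Unconditional instances in this file:
* `TopVertex.top_sum_nonneg_of_adj`, `vertex_sum_nonneg_of_adj` — `P` adjacent to `s`: `P ∉ Y T` forces `sP` red, so TOP = {P ∉ Y} and
  VERTEX({P}) holds on EVERY graph at every neighbour of the source (in `K`-form this is Lemma 2 twice; recorded here in BIC form).
* `TopVertex.top_sum_nonneg_of_nested`, `vertex_sum_nonneg_of_apex` — nested tops (`Y T ⊆ X T` on the top event) make TOP termwise
  nonnegative; with `NestedTop.apex_nested`: VERTEX({P}) for every `P ∉ A` adjacent to all of `A ∖ {s}`, `A ∋ s` any vertex set that pairs of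
  `E` leave only towards `P` (an ARBITRARY graph on the `s`-side `A`, `sP` optional, anything hung at `P`) — THEOREM AV.
[cite: VandenbergHaggstromKahn2005, §1 p. 6 ("Harris' inequality"), §1 p. 3 (open cluster `C_s`)]
-/

noncomputable section

namespace Summit.CriticalPhenomena.PercolationContinuityZ3.Theorems

open Literature.Probability.Percolation
open scoped Classical

namespace Antithetic

namespace TopVertex

variable {V : Type*} [Fintype V]

/-- **Reflection.**  `T ↦ Tᶜ` exchanges the red and the blue cluster: a sum of `Ψ(X T, Y T)` over all colourings equals the sum of
`Ψ(Y T, X T)`. [folklore] -/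
theorem sum_reflect (E : Set (Sym2 V)) (s : V) (Ψ : Set V → Set V → ℝ) :
    ∑ T : Set (Sym2 V), Ψ (openCluster (T ∩ E) s) (openCluster (Tᶜ ∩ E) s) =
    ∑ T : Set (Sym2 V), Ψ (openCluster (Tᶜ ∩ E) s) (openCluster (T ∩ E) s) := by
  refine Fintype.sum_bijective (fun T : Set (Sym2 V) => Tᶜ) compl_bijective _ _ (fun T => ?_)
  simp only [compl_compl]

/-- **The mirror of the top event.**  `Σ_{T : P ∈ Y T, P ∉ X T} (F(X T) − F(Y T))(G(X T) − G(Y T)) = Σ_{T : P ∈ X T, P ∉ Y T} (same)`: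
the summand is invariant under exchanging `X` and `Y`. [this work] -/
theorem sum_top_mirror (E : Set (Sym2 V)) (s P : V) (F G : Set V → ℝ) :
    ∑ T ∈ Finset.univ.filter (fun T : Set (Sym2 V) => P ∈ openCluster (Tᶜ ∩ E) s ∧ P ∉ openCluster (T ∩ E) s),
      (F (openCluster (T ∩ E) s) - F (openCluster (Tᶜ ∩ E) s)) * (G (openCluster (T ∩ E) s) - G (openCluster (Tᶜ ∩ E) s)) =
    ∑ T ∈ Finset.univ.filter (fun T : Set (Sym2 V) => P ∈ openCluster (T ∩ E) s ∧ P ∉ openCluster (Tᶜ ∩ E) s),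
      (F (openCluster (T ∩ E) s) - F (openCluster (Tᶜ ∩ E) s)) * (G (openCluster (T ∩ E) s) - G (openCluster (Tᶜ ∩ E) s)) := by
  rw [Finset.sum_filter, Finset.sum_filter]
  rw [sum_reflect E s (fun A B => if P ∈ B ∧ P ∉ A then (F A - F B) * (G A - G B) else 0)]
  refine Finset.sum_congr rfl fun T _ => ?_
  split_ifs with h
  · ring
  · rfl

/-- **VERTEX({P}) ⟸ TOP(E; P), on every graph.**  If `0 ≤ Σ_{T : P ∈ X T, P ∉ Y T} (F(X T) − F(Y T))(G(X T) − G(Y T))` for all monotone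
`F, G` (the TOP EVENT at `P`), then the |R| = 1 vertex antithetic inequality holds at `P`:
`0 ≤ Σ_{T : ¬(P ∈ X T ∧ P ∈ Y T)} (F(X T) − F(Y T))(G(X T) − G(Y T))` for all monotone `F, G`.  (`{P ∉ Y}`: block freezing
`Box.notY_sum_nonneg`; `{P ∈ Y ∖ X}`: the mirror of the top event.) [this work] -/
theorem vertex_sum_nonneg_of_top (E : Set (Sym2 V)) (s P : V)
    (htop : ∀ F G : Set V → ℝ, Monotone F → Monotone G →
      0 ≤ ∑ T ∈ Finset.univ.filter (fun T : Set (Sym2 V) => P ∈ openCluster (T ∩ E) s ∧ P ∉ openCluster (Tᶜ ∩ E) s),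
        (F (openCluster (T ∩ E) s) - F (openCluster (Tᶜ ∩ E) s)) * (G (openCluster (T ∩ E) s) - G (openCluster (Tᶜ ∩ E) s)))
    {F G : Set V → ℝ} (hF : Monotone F) (hG : Monotone G) :
    0 ≤ ∑ T ∈ Finset.univ.filter (fun T : Set (Sym2 V) =>
        ¬ ((openGraph (T ∩ E)).Reachable s P ∧ (openGraph (Tᶜ ∩ E)).Reachable s P)),
      (F (openCluster (T ∩ E) s) - F (openCluster (Tᶜ ∩ E) s)) * (G (openCluster (T ∩ E) s) - G (openCluster (Tᶜ ∩ E) s)) := by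
  -- split `¬(P ∈ X ∧ P ∈ Y)` along `P ∈ Y`
  rw [← Finset.sum_filter_add_sum_filter_not _ (fun T : Set (Sym2 V) => P ∈ openCluster (Tᶜ ∩ E) s),
    Finset.filter_filter, Finset.filter_filter]
  refine add_nonneg ?_ ?_
  · -- `P ∈ Y ∖ X`: the mirror of the top event
    have hev : Finset.univ.filter (fun T : Set (Sym2 V) =>
          ¬ ((openGraph (T ∩ E)).Reachable s P ∧ (openGraph (Tᶜ ∩ E)).Reachable s P) ∧ P ∈ openCluster (Tᶜ ∩ E) s) =
        Finset.univ.filter (fun T : Set (Sym2 V) => P ∈ openCluster (Tᶜ ∩ E) s ∧ P ∉ openCluster (T ∩ E) s) := by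
      refine Finset.filter_congr fun T _ => ⟨fun h => ⟨h.2, fun hX => h.1 ⟨hX, h.2⟩⟩, fun h => ⟨fun h' => h.2 h'.1, h.1⟩⟩
    rw [hev, sum_top_mirror]
    exact htop F G hF hG
  · -- `P ∉ Y`: block freezing
    have hev : Finset.univ.filter (fun T : Set (Sym2 V) =>
          ¬ ((openGraph (T ∩ E)).Reachable s P ∧ (openGraph (Tᶜ ∩ E)).Reachable s P) ∧ P ∉ openCluster (Tᶜ ∩ E) s) =
        Finset.univ.filter (fun T : Set (Sym2 V) => ∀ Q ∈ ({P} : Set V), Q ∉ openCluster (Tᶜ ∩ E) s) := by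
      refine Finset.filter_congr fun T _ => ⟨fun h => ?_, fun h => ?_⟩
      · intro Q hQ; rw [Set.mem_singleton_iff.1 hQ]; exact h.2
      · exact ⟨fun h' => h P rfl h'.2, h P rfl⟩
    rw [hev]
    have hK₁ : ∀ ⦃A A' B B' : Set V⦄, A ⊆ A' → B' ⊆ B → F A - F B ≤ F A' - F B' :=
      fun A A' B B' hA hB => sub_le_sub (hF hA) (hF hB)
    have hK₂ : ∀ ⦃A A' B B' : Set V⦄, A ⊆ A' → B' ⊆ B → G A - G B ≤ G A' - G B' :=
      fun A A' B B' hA hB => sub_le_sub (hG hA) (hG hB)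
    have hso₁ : ∀ A B : Set V, 0 ≤ (F A - F B) + (F B - F A) := fun A B => by linarith
    have hso₂ : ∀ A B : Set V, 0 ≤ (G A - G B) + (G B - G A) := fun A B => by linarith
    exact Box.notY_sum_nonneg E s {P} (K₁ := fun A B => F A - F B) (K₂ := fun A B => G A - G B) hK₁ hso₁ hK₂ hso₂

/-- **TOP at a neighbour of the source (every graph).**  If `sP ∈ E` (`s ≠ P`), then `P ∉ Y T` forces `sP` red and `P ∈ X T`, so the
top event is `{P ∉ Y T}` and its sum is nonnegative by block freezing — here for all monotone `F⁻ ≤ F⁺`, `G⁻ ≤ G⁺` (TOP_shift).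
[this work] -/
theorem top_sum_nonneg_of_adj (E : Set (Sym2 V)) (s P : V) (hsP : s ≠ P) (hsPE : s(s, P) ∈ E)
    (Fp Fm Gp Gm : Set V → ℝ) (hFp : Monotone Fp) (hFm : Monotone Fm) (hF : ∀ S, Fm S ≤ Fp S)
    (hGp : Monotone Gp) (hGm : Monotone Gm) (hG : ∀ S, Gm S ≤ Gp S) :
    0 ≤ ∑ T ∈ Finset.univ.filter (fun T : Set (Sym2 V) => P ∈ openCluster (T ∩ E) s ∧ P ∉ openCluster (Tᶜ ∩ E) s),
      (Fp (openCluster (T ∩ E) s) - Fm (openCluster (Tᶜ ∩ E) s)) * (Gp (openCluster (T ∩ E) s) - Gm (openCluster (Tᶜ ∩ E) s)) := by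
  have hev : Finset.univ.filter (fun T : Set (Sym2 V) => P ∈ openCluster (T ∩ E) s ∧ P ∉ openCluster (Tᶜ ∩ E) s) =
      Finset.univ.filter (fun T : Set (Sym2 V) => ∀ Q ∈ ({P} : Set V), Q ∉ openCluster (Tᶜ ∩ E) s) := by
    refine Finset.filter_congr fun T _ => ⟨fun h => ?_, fun h => ?_⟩
    · intro Q hQ; rw [Set.mem_singleton_iff.1 hQ]; exact h.2
    · have hPY : P ∉ openCluster (Tᶜ ∩ E) s := h P rfl
      refine ⟨?_, hPY⟩
      by_cases hred : s(s, P) ∈ T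
      · exact TwoStage.Cone.mem_cluster_of_adj (mem_openCluster_self _ s) ((openGraph_adj _ s P).2 ⟨⟨hred, hsPE⟩, hsP⟩)
      · exact absurd (TwoStage.Cone.mem_cluster_of_adj (mem_openCluster_self (Tᶜ ∩ E) s)
          ((openGraph_adj (Tᶜ ∩ E) s P).2 ⟨⟨hred, hsPE⟩, hsP⟩)) hPY
  rw [hev]
  have hK₁ : ∀ ⦃A A' B B' : Set V⦄, A ⊆ A' → B' ⊆ B → Fp A - Fm B ≤ Fp A' - Fm B' :=
    fun A A' B B' hA hB => sub_le_sub (hFp hA) (hFm hB)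
  have hK₂ : ∀ ⦃A A' B B' : Set V⦄, A ⊆ A' → B' ⊆ B → Gp A - Gm B ≤ Gp A' - Gm B' :=
    fun A A' B B' hA hB => sub_le_sub (hGp hA) (hGm hB)
  have hso₁ : ∀ A B : Set V, 0 ≤ (Fp A - Fm B) + (Fp B - Fm A) := fun A B => by linarith [hF A, hF B]
  have hso₂ : ∀ A B : Set V, 0 ≤ (Gp A - Gm B) + (Gp B - Gm A) := fun A B => by linarith [hG A, hG B]
  exact Box.notY_sum_nonneg E s {P} (K₁ := fun A B => Fp A - Fm B) (K₂ := fun A B => Gp A - Gm B) hK₁ hso₁ hK₂ hso₂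

/-- **VERTEX({P}) at every neighbour `P` of the source, on every graph** (BIC form of HOME/THEOREM-OneSided.md Lemma 2 used twice).
[this work] -/
theorem vertex_sum_nonneg_of_adj (E : Set (Sym2 V)) (s P : V) (hsP : s ≠ P) (hsPE : s(s, P) ∈ E)
    {F G : Set V → ℝ} (hF : Monotone F) (hG : Monotone G) :
    0 ≤ ∑ T ∈ Finset.univ.filter (fun T : Set (Sym2 V) =>
        ¬ ((openGraph (T ∩ E)).Reachable s P ∧ (openGraph (Tᶜ ∩ E)).Reachable s P)),
      (F (openCluster (T ∩ E) s) - F (openCluster (Tᶜ ∩ E) s)) * (G (openCluster (T ∩ E) s) - G (openCluster (Tᶜ ∩ E) s)) :=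
  vertex_sum_nonneg_of_top E s P (fun F' G' hF' hG' =>
    top_sum_nonneg_of_adj E s P hsP hsPE F' F' G' G' hF' hF' (fun _ => le_rfl) hG' hG' (fun _ => le_rfl)) hF hG

/-- **TOP under nested tops** (termwise): if `P ∈ X T`, `P ∉ Y T` imply `Y T ⊆ X T`, the shifted top sum is nonnegative. [this work] -/
theorem top_sum_nonneg_of_nested (E : Set (Sym2 V)) (s P : V)
    (hnest : ∀ T : Set (Sym2 V), P ∈ openCluster (T ∩ E) s → P ∉ openCluster (Tᶜ ∩ E) s →
      openCluster (Tᶜ ∩ E) s ⊆ openCluster (T ∩ E) s)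
    (Fp Fm Gp Gm : Set V → ℝ) (_hFp : Monotone Fp) (hFm : Monotone Fm) (hF : ∀ S, Fm S ≤ Fp S)
    (_hGp : Monotone Gp) (hGm : Monotone Gm) (hG : ∀ S, Gm S ≤ Gp S) :
    0 ≤ ∑ T ∈ Finset.univ.filter (fun T : Set (Sym2 V) => P ∈ openCluster (T ∩ E) s ∧ P ∉ openCluster (Tᶜ ∩ E) s),
      (Fp (openCluster (T ∩ E) s) - Fm (openCluster (Tᶜ ∩ E) s)) * (Gp (openCluster (T ∩ E) s) - Gm (openCluster (Tᶜ ∩ E) s)) := by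
  refine Finset.sum_nonneg fun T hT => ?_
  obtain ⟨-, hPX, hPY⟩ := Finset.mem_filter.1 hT
  have hYX := hnest T hPX hPY
  exact mul_nonneg (sub_nonneg.2 ((hFm hYX).trans (hF _))) (sub_nonneg.2 ((hGm hYX).trans (hG _)))

/-- **THEOREM AV (the |R| = 1 vertex antithetic inequality at an apex over the `s`-side, every graph on the `s`-side).**  Let `A ∋ s` be a
vertex set with `P ∉ A` such that every pair of `E` with an end in `A` has its other end in `A ∪ {P}`, and `P` adjacent to every vertex of
`A ∖ {s}` (the graph on `A` is arbitrary, `sP` optional, anything may be hung at `P`).  Then for all monotone `F, G`: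
`0 ≤ Σ_{T : ¬(P ∈ X T ∧ P ∈ Y T)} (F(X T) − F(Y T))·(G(X T) − G(Y T))`. [this work] -/
theorem vertex_sum_nonneg_of_apex (E : Set (Sym2 V)) (s P : V) (A : Set V) (hsA : s ∈ A)
    (hcl : ∀ e ∈ E, ∀ u ∈ e, u ∈ A → ∀ w ∈ e, w ∈ A ∨ w = P)
    (hadj : ∀ v ∈ A, v ≠ s → s(v, P) ∈ E)
    {F G : Set V → ℝ} (hF : Monotone F) (hG : Monotone G) :
    0 ≤ ∑ T ∈ Finset.univ.filter (fun T : Set (Sym2 V) =>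
        ¬ ((openGraph (T ∩ E)).Reachable s P ∧ (openGraph (Tᶜ ∩ E)).Reachable s P)),
      (F (openCluster (T ∩ E) s) - F (openCluster (Tᶜ ∩ E) s)) * (G (openCluster (T ∩ E) s) - G (openCluster (Tᶜ ∩ E) s)) :=
  vertex_sum_nonneg_of_top E s P (fun F' G' hF' hG' =>
    top_sum_nonneg_of_nested E s P (fun T hPX hPY => NestedTop.apex_nested E s P A hsA hcl hadj T hPX hPY)
      F' F' G' G' hF' hF' (fun _ => le_rfl) hG' hG' (fun _ => le_rfl)) hF hG

end TopVertex

end Antithetic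

end Summit.CriticalPhenomena.PercolationContinuityZ3.Theorems
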